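import Mathlib.Analysis.SpecialFunctions.Integrals.Basic
import HarnessLib

/-!
# Exact integration of nested dense polynomials (tooling for Polymath 8b, Theorem 3.15)

Trunk AntSieve, companion to `PolymathGEH.lean` (named fact
`Literature.NumberTheory.Sieve.weakDHL_three_two_of_GEH`, D. H. J. Polymath, *Variants of the Selberg
sieve, and bounded intervals containing many primes*, Res. Math. Sci. 1:12 (2014) = arXiv:1407.4897,
Theorem 3.2(xii)).  The printed proof of Theorem 3.2(xii) ends in the purely numerical **Theorem 3.15**
(§7.4, "Three-dimensional cutoffs", pp. 31–34): a piecewise polynomial `F` on `(3/2)·R₃` built from nine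
cubic pieces on sixty polytopes, for which the two rational numbers
`I(F) = 62082439864241/507343011840` and `J(F) = 9933190664926733/40587440947200` must be evaluated
exactly ("a tedious but straightforward computation", p. 32).  This file provides the kernel-evaluable
exact arithmetic used for that computation:

* `GEHCutoff.Ops α` — a bundle of raw ring operations on a coefficient type (no laws), with
  `Ops.Lawful O ev` saying that an evaluation map `ev : α → ℝ` turns them into the real operations;
  `GEHCutoff.ratOps` (on `ℚ`, lawful for the cast);
* dense univariate polynomials over `α` as `List α` with `Ops.ladd`, `Ops.lmul`, …, bundled as
  `O.list : Ops (List α)`, and their Horner evaluation `leval ev l w`; `Ops.Lawful.list`: evaluation at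
  any real `w` is again lawful — so the construction iterates to the tower `Q1 = List ℚ` (polynomials
  in `u`), `Q2 = List Q1` (in `u, v`), `Q3 = List Q2` (in `u, v, w`) with evaluations `ev1`, `ev2`, `ev3`;
* `Ops.lint O p lo hi` — the exact definite integral `∫_{lo}^{hi} p(w) dw` of a polynomial with
  coefficients AND bounds in `α` (the bounds are polynomials in the outer variables), with
  `integral_leval : ∫ w in ev lo..ev hi, leval ev p w = ev (O.lint p lo hi)` (from `integral_pow`);
* `cellIntegral` — the threefold iterate `∫_{a₀}^{a₁} ∫_{l₁(u)}^{h₁(u)} ∫_{l₂(u,v)}^{h₂(u,v)} q dw dv du ∈ ℚ`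
  of a `Q3` polynomial over a "graph-structured" cell (Polymath 8b, §7.4, display (graph)), with
  `cellIntegral_eq`; and `Q2.isZero` (all coefficients vanish ⇒ the polynomial is zero), used for the
  vanishing-marginal conditions (7.12)–(7.17).

Everything here is elementary calculus of polynomials; the point is that the right-hand sides are
closed `ℚ`-valued terms that the kernel evaluates (`decide`).  No number theory.

## References

* [Polymath8b2014] D. H. J. Polymath, Res. Math. Sci. 1 (2014), Art. 12 = arXiv:1407.4897, §7.4
  (pp. 31–34), Theorem 3.15.
-/

noncomputable section

open MeasureTheory intervalIntegral

namespace Literature.NumberTheory.Sieve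

namespace GEHCutoff

/-! ### Raw operations and lawful evaluations -/

/-- Raw ring operations on a coefficient type (no laws are imposed; correctness is expressed through
`Ops.Lawful`). [folklore] -/
structure Ops (α : Type) where
  /-- zero -/
  zero : α
  /-- one -/
  one : α
  /-- addition -/
  add : α → α → α
  /-- negation -/
  neg : α → α
  /-- multiplication -/
  mul : α → α → α
  /-- the image of a rational constant -/
  ofRat : ℚ → α

/-- `O.Lawful ev`: the evaluation `ev : α → ℝ` maps the raw operations to the real ones. [folklore] -/
structure Ops.Lawful {α : Type} (O : Ops α) (ev : α → ℝ) : Prop where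
  /-- `ev 0 = 0` -/
  zero : ev O.zero = 0
  /-- `ev 1 = 1` -/
  one : ev O.one = 1
  /-- `ev` is additive -/
  add : ∀ a b, ev (O.add a b) = ev a + ev b
  /-- `ev` commutes with negation -/
  neg : ∀ a, ev (O.neg a) = -ev a
  /-- `ev` is multiplicative -/
  mul : ∀ a b, ev (O.mul a b) = ev a * ev b
  /-- `ev` of a rational constant is that constant -/
  ofRat : ∀ q, ev (O.ofRat q) = (q : ℝ)

/-- The rational numbers with their genuine operations. [folklore] -/
@[reducible] def ratOps : Ops ℚ := ⟨0, 1, (· + ·), (- ·), (· * ·), id⟩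

/-- The cast `ℚ → ℝ` is lawful for `ratOps`. [folklore] -/
theorem ratOps_lawful : ratOps.Lawful (fun q : ℚ => (q : ℝ)) :=
  ⟨Rat.cast_zero, Rat.cast_one, Rat.cast_add, Rat.cast_neg, Rat.cast_mul, fun _ => rfl⟩

namespace Ops

variable {α : Type} (O : Ops α)

/-- Coefficientwise sum of dense polynomials. [folklore] -/
def ladd : List α → List α → List α
  | [], q => q
  | a :: p, [] => a :: p
  | a :: p, b :: q => O.add a b :: ladd p q

/-- Coefficientwise negation. [folklore] -/
def lneg (p : List α) : List α := p.map O.neg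

/-- Scalar multiple `a · q`. [folklore] -/
def lsmul (a : α) (q : List α) : List α := q.map (O.mul a)

/-- Product of dense polynomials: `(a + X p) q = a q + X (p q)`. [folklore] -/
def lmul : List α → List α → List α
  | [], _ => []
  | a :: p, q => O.ladd (O.lsmul a q) (O.zero :: lmul p q)

/-- The constant polynomial with a rational value. [folklore] -/
def lofRat (q : ℚ) : List α := [O.ofRat q]

/-- Dense univariate polynomials over `α`, as a new coefficient type. [folklore] -/
@[reducible] def list : Ops (List α) := ⟨[], [O.one], O.ladd, O.lneg, O.lmul, O.lofRat⟩

/-- Powers `a^n` computed with the raw multiplication. [folklore] -/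
def apow (a : α) : ℕ → α
  | 0 => O.one
  | n + 1 => O.mul a (apow a n)

/-- `Σ_k c_k (hi^{k+j+1} - lo^{k+j+1})/(k+j+1)` for the coefficient list `c` started at exponent `j`:
the exact integral of `w^j · Σ_k c_k w^k` from `lo` to `hi`. [folklore] -/
def lintAux : List α → ℕ → α → α → α
  | [], _, _, _ => O.zero
  | c :: cs, j, lo, hi =>
      O.add (O.mul (O.mul c (O.ofRat (1 / ((j : ℚ) + 1))))
          (O.add (O.apow hi (j + 1)) (O.neg (O.apow lo (j + 1)))))
        (lintAux cs (j + 1) lo hi)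

/-- The exact definite integral `∫_{lo}^{hi} p(w) dw` of a dense polynomial whose coefficients and bounds
live in the coefficient type `α`. [folklore] -/
def lint (p : List α) (lo hi : α) : α := O.lintAux p 0 lo hi

end Ops

/-! ### Horner evaluation and its algebra -/

variable {α : Type}

/-- Horner evaluation of a dense polynomial at a real point, through a coefficient evaluation `ev`.
[folklore] -/
def leval (ev : α → ℝ) (l : List α) (w : ℝ) : ℝ := l.foldr (fun c acc => ev c + w * acc) 0

/-- `leval` of the empty list. [folklore] -/
@[simp] theorem leval_nil (ev : α → ℝ) (w : ℝ) : leval ev [] w = 0 := rfl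

/-- `leval` of a cons. [folklore] -/
@[simp] theorem leval_cons (ev : α → ℝ) (c : α) (l : List α) (w : ℝ) :
    leval ev (c :: l) w = ev c + w * leval ev l w := rfl

/-- `leval` is continuous in the point. [folklore] -/
theorem continuous_leval (ev : α → ℝ) : ∀ l : List α, Continuous (leval ev l)
  | [] => by
    show Continuous fun _ : ℝ => (0 : ℝ)
    exact continuous_const
  | c :: l => by
    show Continuous fun w : ℝ => ev c + w * leval ev l w
    exact continuous_const.add (continuous_id.mul (continuous_leval ev l))

variable {O : Ops α} {ev : α → ℝ}

/-- Evaluation of a sum. [folklore] -/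
theorem leval_ladd (h : O.Lawful ev) : ∀ (p q : List α) (w : ℝ),
    leval ev (O.ladd p q) w = leval ev p w + leval ev q w
  | [], q, w => by simp [Ops.ladd]
  | a :: p, [], w => by simp [Ops.ladd]
  | a :: p, b :: q, w => by
    simp only [Ops.ladd, leval_cons, h.add, leval_ladd h p q w]
    ring

/-- Evaluation of a negation. [folklore] -/
theorem leval_lneg (h : O.Lawful ev) : ∀ (p : List α) (w : ℝ), leval ev (O.lneg p) w = -leval ev p w
  | [], w => by simp [Ops.lneg]
  | a :: p, w => by
    have := leval_lneg h p w
    simp only [Ops.lneg, List.map_cons, leval_cons, h.neg] at this ⊢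
    rw [this]
    ring

/-- Evaluation of a scalar multiple. [folklore] -/
theorem leval_lsmul (h : O.Lawful ev) (a : α) : ∀ (q : List α) (w : ℝ),
    leval ev (O.lsmul a q) w = ev a * leval ev q w
  | [], w => by simp [Ops.lsmul]
  | b :: q, w => by
    have := leval_lsmul h a q w
    simp only [Ops.lsmul, List.map_cons, leval_cons, h.mul] at this ⊢
    rw [this]
    ring

/-- Evaluation of a product. [folklore] -/
theorem leval_lmul (h : O.Lawful ev) : ∀ (p q : List α) (w : ℝ),
    leval ev (O.lmul p q) w = leval ev p w * leval ev q w
  | [], q, w => by simp [Ops.lmul]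
  | a :: p, q, w => by
    rw [Ops.lmul, leval_ladd h, leval_lsmul h, leval_cons, leval_cons, h.zero, leval_lmul h p q w]
    ring

/-- **Iterating the construction**: evaluating at a real point is a lawful evaluation of the polynomial
operations `O.list`. [folklore] -/
theorem Ops.Lawful.list (h : O.Lawful ev) (w : ℝ) : O.list.Lawful (fun l => leval ev l w) where
  zero := rfl
  one := by simp [h.one]
  add p q := leval_ladd h p q w
  neg p := leval_lneg h p w
  mul p q := leval_lmul h p q w
  ofRat q := by simp [Ops.lofRat, h.ofRat]

/-- Evaluation of a raw power. [folklore] -/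
theorem ev_apow (h : O.Lawful ev) (a : α) : ∀ n : ℕ, ev (O.apow a n) = ev a ^ n
  | 0 => by simp [Ops.apow, h.one]
  | n + 1 => by rw [Ops.apow, h.mul, ev_apow h a n, pow_succ']

/-! ### Exact integration in the last variable -/

/-- `w^j · p(w)`, the integrand handled by `Ops.lintAux`. [folklore] -/
def levalPow (ev : α → ℝ) (l : List α) (j : ℕ) (w : ℝ) : ℝ := w ^ j * leval ev l w

/-- The recursion `w^j (c + w q(w)) = c w^j + w^{j+1} q(w)`. [folklore] -/
theorem levalPow_cons (ev : α → ℝ) (c : α) (l : List α) (j : ℕ) (w : ℝ) :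
    levalPow ev (c :: l) j w = ev c * w ^ j + levalPow ev l (j + 1) w := by
  simp only [levalPow, leval_cons, pow_succ]
  ring

/-- `levalPow` is continuous. [folklore] -/
theorem continuous_levalPow (ev : α → ℝ) (l : List α) (j : ℕ) : Continuous (levalPow ev l j) :=
  (continuous_pow j).mul (continuous_leval ev l)

/-- **Exactness of `lintAux`**: `∫_{lo}^{hi} w^j p(w) dw = ev (lintAux p j lo hi)`. [folklore] -/
theorem integral_levalPow (h : O.Lawful ev) : ∀ (p : List α) (j : ℕ) (lo hi : α),
    ∫ w in (ev lo)..(ev hi), levalPow ev p j w = ev (O.lintAux p j lo hi)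
  | [], j, lo, hi => by simp [levalPow, Ops.lintAux, h.zero]
  | c :: p, j, lo, hi => by
    simp only [levalPow_cons]
    have hc : Continuous fun w : ℝ => ev c * w ^ j := continuous_const.mul (continuous_pow j)
    rw [intervalIntegral.integral_add (hc.intervalIntegrable _ _)
      ((continuous_levalPow ev p (j + 1)).intervalIntegrable _ _), intervalIntegral.integral_const_mul,
      integral_pow, integral_levalPow h p (j + 1) lo hi, Ops.lintAux, h.add, h.mul, h.mul, h.ofRat, h.add,
      h.neg, ev_apow h, ev_apow h]
    push_cast
    ring

/-- **Exactness of `lint`**: `∫_{lo}^{hi} p(w) dw = ev (lint p lo hi)`. [folklore] -/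
theorem integral_leval (h : O.Lawful ev) (p : List α) (lo hi : α) :
    ∫ w in (ev lo)..(ev hi), leval ev p w = ev (O.lint p lo hi) := by
  rw [Ops.lint, ← integral_levalPow h p 0 lo hi]
  simp [levalPow]

/-! ### The three-level tower `ℚ ⊂ Q1 ⊂ Q2 ⊂ Q3` -/

/-- Dense polynomials in one variable `u` over `ℚ`. [folklore] -/
abbrev Q1 : Type := List ℚ
/-- Dense polynomials in `v` with coefficients in `Q1` (polynomials in `u, v`). [folklore] -/
abbrev Q2 : Type := List Q1
/-- Dense polynomials in `w` with coefficients in `Q2` (polynomials in `u, v, w`). [folklore] -/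
abbrev Q3 : Type := List Q2

/-- Operations on `Q1`. [folklore] -/
@[reducible] def ops1 : Ops Q1 := ratOps.list
/-- Operations on `Q2`. [folklore] -/
@[reducible] def ops2 : Ops Q2 := ops1.list
/-- Operations on `Q3`. [folklore] -/
@[reducible] def ops3 : Ops Q3 := ops2.list

/-- Evaluation of a `Q1` polynomial at `u`. [folklore] -/
def ev1 (u : ℝ) (p : Q1) : ℝ := leval (fun q : ℚ => (q : ℝ)) p u
/-- Evaluation of a `Q2` polynomial at `(u, v)`. [folklore] -/
def ev2 (u v : ℝ) (p : Q2) : ℝ := leval (ev1 u) p v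
/-- Evaluation of a `Q3` polynomial at `(u, v, w)`. [folklore] -/
def ev3 (u v w : ℝ) (p : Q3) : ℝ := leval (ev2 u v) p w

/-- `ev1 u` is lawful. [folklore] -/
theorem lawful1 (u : ℝ) : ops1.Lawful (ev1 u) := ratOps_lawful.list u
/-- `ev2 u v` is lawful. [folklore] -/
theorem lawful2 (u v : ℝ) : ops2.Lawful (ev2 u v) := (lawful1 u).list v
/-- `ev3 u v w` is lawful. [folklore] -/
theorem lawful3 (u v w : ℝ) : ops3.Lawful (ev3 u v w) := (lawful2 u v).list w

/-- `ev3` is continuous in the last variable. [folklore] -/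
theorem continuous_ev3 (u v : ℝ) (p : Q3) : Continuous fun w => ev3 u v w p :=
  continuous_leval (ev2 u v) p

/-- `ev2` is continuous in the last variable. [folklore] -/
theorem continuous_ev2 (u : ℝ) (p : Q2) : Continuous fun v => ev2 u v p :=
  continuous_leval (ev1 u) p

/-- `ev1` is continuous. [folklore] -/
theorem continuous_ev1 (p : Q1) : Continuous fun u => ev1 u p :=
  continuous_leval _ p

/-- **The exact threefold iterated integral** of a `Q3` polynomial over a graph-structured cell
`{a₀ < u < a₁, l₁(u) < v < h₁(u), l₂(u,v) < w < h₂(u,v)}` (Polymath 8b, §7.4, display (graph)): the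
inner bounds are polynomials in the outer variables.  A closed rational term. [cite: Polymath8b2014, Section 7.4] -/
def cellIntegral (q : Q3) (lo2 hi2 : Q2) (lo1 hi1 : Q1) (a0 a1 : ℚ) : ℚ :=
  ratOps.lint (ops1.lint (ops2.lint q lo2 hi2) lo1 hi1) a0 a1

/-- **Correctness of `cellIntegral`**:
`cellIntegral q l₂ h₂ l₁ h₁ a₀ a₁ = ∫_{a₀}^{a₁} ∫_{l₁(u)}^{h₁(u)} ∫_{l₂(u,v)}^{h₂(u,v)} q(u,v,w) dw dv du`.
[cite: Polymath8b2014, Section 7.4] -/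
theorem cellIntegral_eq (q : Q3) (lo2 hi2 : Q2) (lo1 hi1 : Q1) (a0 a1 : ℚ) :
    (cellIntegral q lo2 hi2 lo1 hi1 a0 a1 : ℝ) =
      ∫ u in (a0 : ℝ)..a1, ∫ v in (ev1 u lo1)..(ev1 u hi1),
        ∫ w in (ev2 u v lo2)..(ev2 u v hi2), ev3 u v w q := by
  have h3 : ∀ u v, ∫ w in (ev2 u v lo2)..(ev2 u v hi2), ev3 u v w q = ev2 u v (ops2.lint q lo2 hi2) :=
    fun u v => integral_leval (lawful2 u v) q lo2 hi2
  have h2 : ∀ u, ∫ v in (ev1 u lo1)..(ev1 u hi1), ev2 u v (ops2.lint q lo2 hi2) =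
      ev1 u (ops1.lint (ops2.lint q lo2 hi2) lo1 hi1) :=
    fun u => integral_leval (lawful1 u) _ lo1 hi1
  have h1 := integral_leval ratOps_lawful (ops1.lint (ops2.lint q lo2 hi2) lo1 hi1) a0 a1
  simp_rw [h3, h2]
  exact h1.symm

/-! ### Vanishing test -/

/-- All coefficients of a `Q2` polynomial vanish (a decidable, sufficient condition for being the
zero function; used for the marginal conditions (7.12)–(7.17) of Polymath 8b). [cite: Polymath8b2014, Section 7.4] -/
def Q2.isZero (p : Q2) : Bool := p.all fun c => c.all fun r => r == 0

/-- A `Q1` polynomial with vanishing coefficients is zero. [folklore] -/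
theorem ev1_eq_zero_of_all : ∀ {p : Q1}, (p.all fun r => r == 0) = true → ∀ u : ℝ, ev1 u p = 0
  | [], _, _ => rfl
  | c :: p, h, u => by
    rw [List.all_cons, Bool.and_eq_true, beq_iff_eq] at h
    show (c : ℝ) + u * ev1 u p = 0
    rw [ev1_eq_zero_of_all h.2 u, h.1]
    simp

/-- **Vanishing test**: `Q2.isZero p ⇒ p(u, v) = 0`. [cite: Polymath8b2014, Section 7.4] -/
theorem ev2_eq_zero_of_isZero : ∀ {p : Q2}, Q2.isZero p = true → ∀ u v : ℝ, ev2 u v p = 0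
  | [], _, _, _ => rfl
  | c :: p, h, u, v => by
    rw [Q2.isZero, List.all_cons, Bool.and_eq_true] at h
    show ev1 u c + v * ev2 u v p = 0
    rw [ev1_eq_zero_of_all h.1 u, ev2_eq_zero_of_isZero h.2 u v]
    simp

end GEHCutoff

end Literature.NumberTheory.Sieve
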